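import Summits.NavierStokesRegularity.NavierStokesRegularity.Theorems.CircuitPump.Negative.LoadBearing
import Literature.Analysis.ODE.OneSidedComparison

/-!
# The gate `σ`-lemma of the damped Toda transfer gate (crux `PerpetualPump.CircuitPump`,
# stmt-NavierStokesRegularity-1834; line `singular-clock-gspt`, sub-goal `toda_gate_sigma` of `stub_clockBox`)

Pure real analysis for `u' = -u - v² + p`, `v' = v (u - w) - v + s`, `w' = -ν w + v² + r` on `[0, T]`,
`T ≤ 1/2` (`|p|, |r| ≤ P`, `0 ≤ s ≤ P`, `1 ≤ ν ≤ 2`, `u(0) = A ≥ 1000 (1 + P)`, `w(0) ∈ [0, 1]`,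
`v(0) ∈ (0, 1]`). With `S = u + w`, `D = u - w`, `R = √(D² + 2 v²)`, `σ = S - R`:
* `gate_hasDerivWithinAt_sigma`: the exact identity `σ' = -k σ + (1 - ν) v² / R + π`,
  `k = ((1 + ν) R + (ν - 1) D) / (2R) ≥ 0`, `π = p + r - (D (p - r) + 2 v s) / R`, `|π| ≤ 6P`;
* `gate_core`: where `R ≥ A/4`, linear comparison with zero source (`nonpos_of_deriv_right_le_mul`,
  from the tree lemma `Literature.Analysis.ODE.le_linearComparison`) for `σ - 6Pt - 2` and for
  `σ + 6Pt + (4(ν-1)/A)(w + M t) + 2` (the forcing `(ν - 1) v² / R ≤ (4 (ν - 1) / A) v²` is dominated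
  by the derivative of `(4 (ν - 1) / A)(w + M t)`) gives `-2 - 15 (ν - 1) - 6 P t ≤ σ ≤ 2 + 6 P t`,
  whence `u ≥ σ / 2`, `S ≥ A e^{-2t} - (3P + 40)` and `R = S - σ ≥ A / 3 > A / 4`;
* `toda_gate_sigma`: the bounds needing no bootstrap (`v ≥ 0`, `w ≥ -P t`, `S ≤ A + 1 + 3 P t`, and
  `w ≤ A + 1 + P` from the energy `u² + v² + w²`, whose derivative has no cubic terms), then the
  continuity argument (`Literature.Analysis.ODE.maximalTimeP`) on the closed condition `R ≥ A / 4`.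
[folklore]
-/

noncomputable section

-- the summit namespace `…NavierStokesRegularity.NavierStokesRegularity…` is the tree convention
set_option linter.dupNamespace false

namespace Summit.NavierStokesRegularity.NavierStokesRegularity.Theorems.PerpetualPumpCircuitPump

open Set Filter Topology
open Literature.Analysis.ODE

/-- If `g' ≤ β g` on `[a, b)` (`β` continuous) and `g a ≤ 0`, then `g ≤ 0` on `[a, b]`. [folklore] -/
theorem nonpos_of_deriv_right_le_mul {a b : ℝ} {g g' β : ℝ → ℝ} (hg : ContinuousOn g (Icc a b))
    (hg' : ∀ t ∈ Ico a b, HasDerivWithinAt g (g' t) (Ici t) t) (hβ : ContinuousOn β (Icc a b))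
    (bound : ∀ t ∈ Ico a b, g' t ≤ β t * g t) (ha : g a ≤ 0) {t : ℝ} (ht : t ∈ Icc a b) :
    g t ≤ 0 := by
  have h := le_linearComparison (A := fun _ => 0) hg hg' continuousOn_const hβ
    (fun s hs => by simpa only [zero_add] using bound s hs) ht
  simp only [zero_mul, intervalIntegral.integral_zero, add_zero] at h
  exact h.trans (mul_nonpos_of_nonneg_of_nonpos (Real.exp_pos _).le ha)

/-- If `β g ≤ g'` on `[a, b)` (`β` continuous) and `0 ≤ g a`, then `0 ≤ g` on `[a, b]`. [folklore] -/
theorem nonneg_of_mul_le_deriv_right {a b : ℝ} {g g' β : ℝ → ℝ} (hg : ContinuousOn g (Icc a b))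
    (hg' : ∀ t ∈ Ico a b, HasDerivWithinAt g (g' t) (Ici t) t) (hβ : ContinuousOn β (Icc a b))
    (bound : ∀ t ∈ Ico a b, β t * g t ≤ g' t) (ha : 0 ≤ g a) {t : ℝ} (ht : t ∈ Icc a b) :
    0 ≤ g t := by
  have h := nonpos_of_deriv_right_le_mul (g := fun s => -g s) (g' := fun s => -g' s) hg.neg
    (fun s hs => (hg' s hs).neg) hβ
    (fun s hs => by have h1 := bound s hs; have h2 := mul_neg (β s) (g s); linarith)
    (by linarith) ht
  linarith

/-- **The exact `σ`-identity of the damped Toda gate**: with `u' = -u - v² + a`,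
`v' = v(u - w) - v + c`, `w' = -ν w + v² + b` at `t` and `R = √((u - w)² + 2 v²) > 0`, `σ = u + w - R`
has right derivative `-k σ + (1 - ν) v² / R + π` (uses only `R² = (u - w)² + 2 v²`). [folklore] -/
theorem gate_hasDerivWithinAt_sigma {u v w : ℝ → ℝ} {ν a b c t R : ℝ}
    (hu : HasDerivWithinAt u (-u t - v t ^ 2 + a) (Ici t) t)
    (hv : HasDerivWithinAt v (v t * (u t - w t) - v t + c) (Ici t) t)
    (hw : HasDerivWithinAt w (-ν * w t + v t ^ 2 + b) (Ici t) t)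
    (hR : Real.sqrt ((u t - w t) ^ 2 + 2 * v t ^ 2) = R) (hR0 : 0 < R) :
    HasDerivWithinAt (fun y => u y + w y - Real.sqrt ((u y - w y) ^ 2 + 2 * v y ^ 2))
      (-(((1 + ν) * R + (ν - 1) * (u t - w t)) / (2 * R)) * (u t + w t - R) +
        (1 - ν) * v t ^ 2 / R + (a + b - ((u t - w t) * (a - b) + 2 * v t * c) / R)) (Ici t) t := by
  have hQ0 : 0 < (u t - w t) ^ 2 + 2 * v t ^ 2 := by
    have h := hR0
    rw [← hR, Real.sqrt_pos] at h
    exact h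
  have hQ : HasDerivWithinAt (fun y => (u y - w y) ^ 2 + 2 * v y ^ 2)
      (2 * (u t - w t) * ((-u t - v t ^ 2 + a) - (-ν * w t + v t ^ 2 + b)) +
        2 * (2 * v t * (v t * (u t - w t) - v t + c))) (Ici t) t := by
    refine (((hu.sub hw).fun_pow 2).add ((hv.fun_pow 2).const_mul 2)).congr_deriv ?_
    norm_num
  have hσ := (hu.add hw).sub (hQ.sqrt hQ0.ne')
  rw [hR] at hσ
  refine hσ.congr_deriv ?_
  have hR2 : R ^ 2 = (u t - w t) ^ 2 + 2 * v t ^ 2 := by rw [← hR]; exact Real.sq_sqrt hQ0.le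
  field_simp
  linear_combination (-(1 + ν)) * hR2

/-- **Pointwise gate bounds.** With `R = √((U - W)² + 2 V²) > 0`, `|a|, |b| ≤ P`, `0 ≤ c ≤ P`,
`ν ≥ 1`: `|U - W| ≤ R`, `V² ≤ R²`, `k ≥ 0` and `|π| ≤ 6 P`. [folklore] -/
theorem gate_pointwise {U V W a b c P ν R : ℝ} (hR : Real.sqrt ((U - W) ^ 2 + 2 * V ^ 2) = R)
    (hR0 : 0 < R) (ha : |a| ≤ P) (hb : |b| ≤ P) (hc : 0 ≤ c ∧ c ≤ P) (hν : 1 ≤ ν) :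
    |U - W| ≤ R ∧ V ^ 2 ≤ R ^ 2 ∧ 0 ≤ ((1 + ν) * R + (ν - 1) * (U - W)) / (2 * R) ∧
      |a + b - ((U - W) * (a - b) + 2 * V * c) / R| ≤ 6 * P := by
  have hQ0 : 0 ≤ (U - W) ^ 2 + 2 * V ^ 2 := by positivity
  have hR2 : R ^ 2 = (U - W) ^ 2 + 2 * V ^ 2 := by rw [← hR]; exact Real.sq_sqrt hQ0
  have hD : |U - W| ≤ R := abs_le_of_sq_le_sq (by nlinarith [sq_nonneg V]) hR0.le
  have hV2 : V ^ 2 ≤ R ^ 2 := by nlinarith [sq_nonneg (U - W), sq_nonneg V]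
  have hV : |V| ≤ R := abs_le_of_sq_le_sq hV2 hR0.le
  refine ⟨hD, hV2, ?_, ?_⟩
  · refine div_nonneg ?_ (by positivity)
    have h1 := (abs_le.mp hD).1
    have h2 : 0 ≤ (ν - 1) * (U - W + R) := mul_nonneg (by linarith) (by linarith)
    nlinarith
  · have hab : |a - b| ≤ 2 * P := (abs_sub a b).trans (by linarith)
    have e1 : |U - W| * |a - b| ≤ R * (2 * P) := mul_le_mul hD hab (abs_nonneg _) hR0.le
    have e2 : |V| * c ≤ R * P := mul_le_mul hV hc.2 hc.1 hR0.le
    have h1 : |(U - W) * (a - b) + 2 * V * c| ≤ R * (4 * P) := by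
      calc |(U - W) * (a - b) + 2 * V * c| ≤ |(U - W) * (a - b)| + |2 * V * c| := abs_add_le _ _
        _ = |U - W| * |a - b| + 2 * (|V| * c) := by
            rw [abs_mul, abs_mul, abs_mul, abs_two, abs_of_nonneg hc.1, mul_assoc]
        _ ≤ R * (4 * P) := by linarith
    have h2 : |((U - W) * (a - b) + 2 * V * c) / R| ≤ 4 * P := by
      rw [abs_div, abs_of_pos hR0, div_le_iff₀ hR0]
      linarith
    calc |a + b - ((U - W) * (a - b) + 2 * V * c) / R|
        ≤ |a + b| + |((U - W) * (a - b) + 2 * V * c) / R| := abs_sub _ _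
      _ ≤ (|a| + |b|) + 4 * P := add_le_add (abs_add_le _ _) h2
      _ ≤ 6 * P := by linarith

/-- **Bootstrap step.** On `[0, T]`, `T ≤ 1/2`, where `R ≥ A / 4` and `-P t ≤ w ≤ A + 1 + P`:
`-2 - 15(ν - 1) - 6Pt ≤ σ ≤ 2 + 6Pt` (linear comparison for `σ - 6Pt - 2` and
`σ + 6Pt + (4(ν-1)/A)(w + Mt) + 2`, `M = 2(A + 1 + P) + P`), then `u ≥ σ/2`,
`S ≥ (A + w₀) e^{-νt} - (9 + 4P) t`, and `R = S - σ ≥ A/3` (`e^{-1} > 0.3678`). [folklore] -/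
theorem gate_core {ν P T A : ℝ} {u v w p r s : ℝ → ℝ} (hν1 : 1 ≤ ν) (hν2 : ν ≤ 2) (hP : 0 ≤ P)
    (hT : T ≤ 1 / 2) (hA : 1000 * (1 + P) ≤ A) (hu0 : u 0 = A) (hw0 : 0 ≤ w 0) (hw1 : w 0 ≤ 1)
    (hv0 : 0 ≤ v 0) (hv1 : v 0 ≤ 1)
    (hu : ContinuousOn u (Icc 0 T)) (hv : ContinuousOn v (Icc 0 T)) (hw : ContinuousOn w (Icc 0 T))
    (hu' : ∀ t ∈ Ico 0 T, HasDerivWithinAt u (-u t - v t ^ 2 + p t) (Ici t) t)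
    (hv' : ∀ t ∈ Ico 0 T, HasDerivWithinAt v (v t * (u t - w t) - v t + s t) (Ici t) t)
    (hw' : ∀ t ∈ Ico 0 T, HasDerivWithinAt w (-ν * w t + v t ^ 2 + r t) (Ici t) t)
    (hp : ∀ t ∈ Icc 0 T, |p t| ≤ P) (hr : ∀ t ∈ Icc 0 T, |r t| ≤ P)
    (hs : ∀ t ∈ Icc 0 T, 0 ≤ s t ∧ s t ≤ P)
    (hwlo : ∀ t ∈ Icc 0 T, -(P * t) ≤ w t) (hwup : ∀ t ∈ Icc 0 T, w t ≤ A + 1 + P)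
    (hR4 : ∀ t ∈ Icc 0 T, A / 4 ≤ Real.sqrt ((u t - w t) ^ 2 + 2 * v t ^ 2)) :
    ∀ t ∈ Icc 0 T,
      A * Real.exp (-2 * t) - (3 * P + 40) ≤ u t + w t ∧
      A / 3 ≤ Real.sqrt ((u t - w t) ^ 2 + 2 * v t ^ 2) ∧
      |u t + w t - Real.sqrt ((u t - w t) ^ 2 + 2 * v t ^ 2)| ≤ 2 + 15 * (ν - 1) + 6 * P * t := by
  set R : ℝ → ℝ := fun t => Real.sqrt ((u t - w t) ^ 2 + 2 * v t ^ 2) with hRdef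
  set σ : ℝ → ℝ := fun t => u t + w t - R t with hσdef
  set k : ℝ → ℝ := fun t => ((1 + ν) * R t + (ν - 1) * (u t - w t)) / (2 * R t) with hkdef
  set π : ℝ → ℝ := fun t => p t + r t - ((u t - w t) * (p t - r t) + 2 * v t * s t) / R t
    with hπdef
  have hA0 : 0 < A := by linarith
  have hB0 : 0 ≤ A + 1 + P := by linarith
  have hR0 : ∀ t ∈ Icc 0 T, 0 < R t := fun t ht => lt_of_lt_of_le (by positivity) (hR4 t ht)
  have hRc : ContinuousOn R (Icc 0 T) :=
    (((hu.sub hw).fun_pow 2).add (continuousOn_const.mul (hv.fun_pow 2))).sqrt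
  have hσc : ContinuousOn σ (Icc 0 T) := (hu.add hw).sub hRc
  have hkc : ContinuousOn (fun t => -k t) (Icc 0 T) :=
    (((continuousOn_const.mul hRc).add (continuousOn_const.mul (hu.sub hw))).div
      (continuousOn_const.mul hRc) fun t ht => (mul_pos two_pos (hR0 t ht)).ne').neg
  have hσ' : ∀ t ∈ Ico 0 T, HasDerivWithinAt σ
      (-k t * σ t + (1 - ν) * v t ^ 2 / R t + π t) (Ici t) t := fun t ht =>
    gate_hasDerivWithinAt_sigma (hu' t ht) (hv' t ht) (hw' t ht) rfl (hR0 t (Ico_subset_Icc_self ht))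
  have hσ0 : -1 ≤ σ 0 ∧ σ 0 ≤ 2 := by
    have hv2 : v 0 ^ 2 ≤ 1 := pow_le_one₀ hv0 hv1
    have hlo : A - w 0 ≤ R 0 :=
      (Real.le_sqrt' (by linarith)).mpr (by rw [hu0]; linarith [sq_nonneg (v 0)])
    have hhi : R 0 ≤ A - w 0 + 1 := Real.sqrt_le_iff.mpr ⟨by linarith, by rw [hu0]; linarith⟩
    simp only [hσdef, hu0]
    constructor <;> linarith
  have hpt : ∀ t ∈ Ico 0 T, |u t - w t| ≤ R t ∧ 0 ≤ k t ∧ |π t| ≤ 6 * P ∧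
      (1 - ν) * v t ^ 2 / R t ≤ 0 ∧ -(4 * (ν - 1) / A * v t ^ 2) ≤ (1 - ν) * v t ^ 2 / R t := by
    intro t ht
    have ht' := Ico_subset_Icc_self ht
    obtain ⟨hD, -, hk, hπ⟩ := gate_pointwise rfl (hR0 t ht') (hp t ht') (hr t ht') (hs t ht') hν1
    refine ⟨hD, hk, hπ, div_nonpos_of_nonpos_of_nonneg
      (mul_nonpos_of_nonpos_of_nonneg (by linarith) (sq_nonneg _)) (hR0 t ht').le, ?_⟩
    have h1 := div_le_div_of_nonneg_left (sq_nonneg (v t)) (by positivity : 0 < A / 4) (hR4 t ht')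
    have h2 := mul_le_mul_of_nonneg_left h1 (sub_nonneg.2 hν1)
    have e1 : (1 - ν) * v t ^ 2 / R t = -((ν - 1) * (v t ^ 2 / R t)) := by ring
    have e2 : (ν - 1) * (v t ^ 2 / (A / 4)) = 4 * (ν - 1) / A * v t ^ 2 := by ring
    linarith
  -- upper bound `σ ≤ 2 + 6 P t`: `(σ - 6Pt - 2)' ≤ -k (σ - 6Pt - 2)`
  have hup : ∀ t ∈ Icc 0 T, σ t ≤ 2 + 6 * P * t := by
    intro t ht
    have h := nonpos_of_deriv_right_le_mul (g := fun y => σ y - 6 * P * y - 2)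
      (g' := fun y => -k y * σ y + (1 - ν) * v y ^ 2 / R y + π y - 6 * P * 1) (a := 0) (b := T)
      ((hσc.sub (continuousOn_const.mul continuousOn_id)).sub continuousOn_const)
      (fun x hx => ((hσ' x hx).sub ((hasDerivAt_id' x).const_mul (6 * P)).hasDerivWithinAt).sub_const 2)
      hkc (fun x hx => by
        obtain ⟨-, hk, hπ, hneg, -⟩ := hpt x hx
        have h1 := (abs_le.mp hπ).2
        have h2 : 0 ≤ k x * (6 * P * x + 2) :=
          mul_nonneg hk (by have := mul_nonneg hP hx.1; linarith)
        linarith)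
      (by simp only [mul_zero, sub_zero]; linarith [hσ0.2]) ht
    linarith
  -- lower bound `σ ≥ -2 - 15 (ν - 1) - 6 P t`: `g' ≥ -k g` for `g = σ + 6Pt + L (w + M t) + 2`
  have hlow : ∀ t ∈ Icc 0 T, -(2 + 15 * (ν - 1) + 6 * P * t) ≤ σ t := by
    intro t ht
    set L : ℝ := 4 * (ν - 1) / A with hL
    set M : ℝ := 2 * (A + 1 + P) + P with hM
    have hL0 : 0 ≤ L := by rw [hL]; exact div_nonneg (by linarith) hA0.le
    have hM0 : 0 ≤ M := by rw [hM]; linarith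
    have h := nonneg_of_mul_le_deriv_right
      (g := fun y => σ y + 6 * P * y + L * (w y + M * y) + 2)
      (g' := fun y => -k y * σ y + (1 - ν) * v y ^ 2 / R y + π y + 6 * P * 1 +
        L * (-ν * w y + v y ^ 2 + r y + M * 1)) (a := 0) (b := T)
      (((hσc.add (continuousOn_const.mul continuousOn_id)).add
        (continuousOn_const.mul (hw.add (continuousOn_const.mul continuousOn_id)))).add
        continuousOn_const)
      (fun x hx => (((hσ' x hx).add ((hasDerivAt_id' x).const_mul (6 * P)).hasDerivWithinAt).add
        (((hw' x hx).add ((hasDerivAt_id' x).const_mul M).hasDerivWithinAt).const_mul L)).add_const 2)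
      hkc (fun x hx => by
        have hx' := Ico_subset_Icc_self hx
        obtain ⟨-, hk, hπ, -, hdom⟩ := hpt x hx
        have h1 := (abs_le.mp hπ).1
        have h2 := (abs_le.mp (hr x hx')).1
        have e1 : ν * (w x - (A + 1 + P)) ≤ 0 :=
          mul_nonpos_of_nonneg_of_nonpos (by linarith) (by linarith [hwup x hx'])
        have e2 : (ν - 2) * (A + 1 + P) ≤ 0 := mul_nonpos_of_nonpos_of_nonneg (by linarith) hB0
        have h4 : 0 ≤ L * (-ν * w x + r x + M) := mul_nonneg hL0 (by rw [hM]; linarith)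
        have h5 : 0 ≤ w x + M * x := by
          have : P * x ≤ M * x := mul_le_mul_of_nonneg_right (by rw [hM]; linarith) hx.1
          linarith [hwlo x hx']
        have h6 : 0 ≤ k x * (6 * P * x + L * (w x + M * x) + 2) :=
          mul_nonneg hk (by linarith [mul_nonneg hL0 h5, mul_nonneg hP hx.1])
        have h7 : L * v x ^ 2 = 4 * (ν - 1) / A * v x ^ 2 := by rw [hL]
        linarith)
      (by simp only [mul_zero, add_zero]; linarith [hσ0.1, mul_nonneg hL0 hw0]) ht
    have hMt : M * t ≤ M * (1 / 2) := mul_le_mul_of_nonneg_left (ht.2.trans hT) hM0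
    have h8 : 4 * (w t + M * t) ≤ 15 * A := by have := hwup t ht; rw [hM] at hMt ⊢; linarith
    have h9 : L * (w t + M * t) ≤ 15 * (ν - 1) := by
      rw [hL, div_mul_eq_mul_div, div_le_iff₀ hA0]
      linarith [mul_le_mul_of_nonneg_left h8 (sub_nonneg.2 hν1)]
    linarith
  intro t ht
  have habs : |σ t| ≤ 2 + 15 * (ν - 1) + 6 * P * t :=
    abs_le.mpr ⟨hlow t ht, by linarith [hup t ht]⟩
  -- `S ≥ (A + w 0) e^{-ν t} - (9 + 4P) t` from `u ≥ σ / 2 ≥ -(9 + 2P)`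
  have hS := exp_mul_le_of_le_deriv_right (f := fun y => u y + w y + (9 + 4 * P) * y)
    (f' := fun y => -u y - v y ^ 2 + p y + (-ν * w y + v y ^ 2 + r y) + (9 + 4 * P) * 1) (β := -ν)
    (a := 0) (b := T) ((hu.add hw).add (continuousOn_const.mul continuousOn_id))
    (fun x hx => ((hu' x hx).add (hw' x hx)).add
      ((hasDerivAt_id' x).const_mul (9 + 4 * P)).hasDerivWithinAt)
    (fun x hx => by
      have hx' := Ico_subset_Icc_self hx
      have h1 := (abs_le.mp (hp x hx')).1
      have h2 := (abs_le.mp (hr x hx')).1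
      obtain ⟨hD, -, -, -, -⟩ := hpt x hx
      have h3 := (abs_le.mp hD).1
      have hux : -(9 + 2 * P) ≤ u x := by
        have e : u x = (σ x + R x + (u x - w x)) / 2 := by simp only [hσdef]; ring
        have hPx : P * x ≤ P * (1 / 2) := mul_le_mul_of_nonneg_left (hx.2.le.trans hT) hP
        linarith [hlow x hx']
      have h5 : 0 ≤ (ν - 1) * (u x + (9 + 2 * P)) := mul_nonneg (by linarith) (by linarith)
      have h6 : 0 ≤ (2 - ν) * (9 + 2 * P) := mul_nonneg (by linarith) (by linarith)
      have h7 : 0 ≤ ν * ((9 + 4 * P) * x) := mul_nonneg (by linarith) (mul_nonneg (by linarith) hx.1)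
      linarith) t ht
  simp only [mul_zero, add_zero, sub_zero, hu0] at hS
  have hexp : A * Real.exp (-2 * t) ≤ A * Real.exp (-ν * t) := mul_le_mul_of_nonneg_left
    (Real.exp_le_exp.mpr (by have := mul_nonneg (by linarith : 0 ≤ 2 - ν) ht.1; linarith)) hA0.le
  have hexp1 : A * 0.3678 ≤ A * Real.exp (-2 * t) := by
    refine mul_le_mul_of_nonneg_left ?_ hA0.le
    have h1 : Real.exp (-1) ≤ Real.exp (-2 * t) := Real.exp_le_exp.mpr (by linarith [ht.2])
    have h2 := one_div_le_one_div_of_le (Real.exp_pos 1) Real.exp_one_lt_d9.le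
    rw [Real.exp_neg, inv_eq_one_div] at h1
    linarith [show (0.3678 : ℝ) ≤ 1 / 2.7182818286 by norm_num]
  have hw0e := mul_nonneg hw0 (Real.exp_pos (-ν * t)).le
  have hPt : P * t ≤ P * (1 / 2) := mul_le_mul_of_nonneg_left (ht.2.trans hT) hP
  have ht2 : t ≤ 1 / 2 := ht.2.trans hT
  refine ⟨by linarith, ?_, habs⟩
  have hσt := hup t ht
  have e : R t = u t + w t - σ t := by simp only [hσdef]; ring
  show A / 3 ≤ R t
  linarith

/-- **Gate `σ`-lemma (transfer completeness of the damped Toda gate).** For the gate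
`u' = −u − v² + p`, `v' = v(u − w) − v + s`, `w' = −ν w + v² + r` on `[0,T]`, `T ≤ 1/2`, from
`u(0) = A ≥ 1000(1+P)`, `w(0) ∈ [0,1]`, `v(0) ∈ (0,1]` (`|p|, |r| ≤ P`, `s ∈ [0, P]`, `ν ∈ [1, 2]`):
`v ≥ 0`, `w ≥ −Pt`, `A e^{−2t} − (3P + 40) ≤ u + w ≤ A + 1 + 3Pt`, `R = √((u−w)² + 2v²) ≥ A/3` and
`|u + w − R| ≤ 2 + 15(ν−1) + 6Pt`. Proof: the a priori bounds `v ≥ 0` (`s ≥ 0`), `w ≥ -P t`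
(`(w + Pt)' ≥ -ν (w + Pt)`), `S ≤ A + 1 + 3Pt` (`(S - 3Pt)' ≤ -(S - 3Pt)`), `w ≤ A + 1 + P`
(`E = u² + v² + w²`, `E' ≤ 3P²/2`); then the continuity argument on the closed condition `R ≥ A/4`
with `gate_core`. [folklore] -/
theorem toda_gate_sigma :
    ∀ (ν P T A : ℝ) (u v w p r s : ℝ → ℝ),
    1 ≤ ν → ν ≤ 2 → 0 ≤ P → 0 < T → T ≤ 1 / 2 → 1000 * (1 + P) ≤ A →
    u 0 = A → 0 ≤ w 0 → w 0 ≤ 1 → 0 < v 0 → v 0 ≤ 1 →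
    ContinuousOn u (Set.Icc 0 T) → ContinuousOn v (Set.Icc 0 T) → ContinuousOn w (Set.Icc 0 T) →
    (∀ t ∈ Set.Ico 0 T, HasDerivWithinAt u (-u t - v t ^ 2 + p t) (Set.Ici t) t) →
    (∀ t ∈ Set.Ico 0 T, HasDerivWithinAt v (v t * (u t - w t) - v t + s t) (Set.Ici t) t) →
    (∀ t ∈ Set.Ico 0 T, HasDerivWithinAt w (-ν * w t + v t ^ 2 + r t) (Set.Ici t) t) →
    (∀ t ∈ Set.Icc 0 T, |p t| ≤ P) → (∀ t ∈ Set.Icc 0 T, |r t| ≤ P) →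
    (∀ t ∈ Set.Icc 0 T, 0 ≤ s t ∧ s t ≤ P) →
    ∀ t ∈ Set.Icc 0 T,
      0 ≤ v t ∧ -(P * t) ≤ w t ∧
      A * Real.exp (-2 * t) - (3 * P + 40) ≤ u t + w t ∧ u t + w t ≤ A + 1 + 3 * P * t ∧
      A / 3 ≤ Real.sqrt ((u t - w t) ^ 2 + 2 * v t ^ 2) ∧
      |u t + w t - Real.sqrt ((u t - w t) ^ 2 + 2 * v t ^ 2)| ≤ 2 + 15 * (ν - 1) + 6 * P * t := by
  intro ν P T A u v w p r s hν1 hν2 hP hT hT2 hA hu0 hw0 hw1 hv0 hv1 hu hv hw hu' hv' hw' hp hr hs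
  have hν0 : 0 ≤ ν := by linarith
  have hA0 : 0 < A := by linarith
  -- a priori: `w + P t ≥ 0`
  have hwlo : ∀ t ∈ Icc 0 T, -(P * t) ≤ w t := by
    intro t ht
    have h := exp_mul_le_of_le_deriv_right (f := fun y => w y + P * y)
      (f' := fun y => -ν * w y + v y ^ 2 + r y + P * 1) (β := -ν) (a := 0) (b := T)
      (hw.add (continuousOn_const.mul continuousOn_id))
      (fun x hx => (hw' x hx).add ((hasDerivAt_id' x).const_mul P).hasDerivWithinAt)
      (fun x hx => by
        have h1 := (abs_le.mp (hr x (Ico_subset_Icc_self hx))).1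
        have h2 : 0 ≤ ν * (P * x) := mul_nonneg hν0 (mul_nonneg hP hx.1)
        linarith [sq_nonneg (v x)]) t ht
    have h0 : 0 ≤ (w 0 + P * 0) * Real.exp (-ν * (t - 0)) :=
      mul_nonneg (by simpa using hw0) (Real.exp_pos _).le
    linarith
  -- a priori: `v ≥ 0`, `S ≤ A + 1 + 3 P t`, `w ≤ A + 1 + P`
  have hap : ∀ t ∈ Icc 0 T, 0 ≤ v t ∧ u t + w t ≤ A + 1 + 3 * P * t ∧ w t ≤ A + 1 + P := by
    intro t ht
    refine ⟨?_, ?_, ?_⟩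
    · exact nonneg_of_mul_le_deriv_right (β := fun y => u y - w y - 1) hv hv'
        ((hu.sub hw).sub continuousOn_const)
        (fun x hx => by have := (hs x (Ico_subset_Icc_self hx)).1; linarith) hv0.le ht
    · have h := le_mul_exp_of_deriv_right_le (f := fun y => u y + w y - 3 * P * y)
        (f' := fun y => -u y - v y ^ 2 + p y + (-ν * w y + v y ^ 2 + r y) - 3 * P * 1) (β := -1)
        (a := 0) (b := T) ((hu.add hw).sub (continuousOn_const.mul continuousOn_id))
        (fun x hx => ((hu' x hx).add (hw' x hx)).sub
          ((hasDerivAt_id' x).const_mul (3 * P)).hasDerivWithinAt)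
        (fun x hx => by
          have hx' := Ico_subset_Icc_self hx
          have h1 := (abs_le.mp (hp x hx')).2
          have h2 := (abs_le.mp (hr x hx')).2
          have h3 : 0 ≤ (ν - 1) * (w x + P * x) := mul_nonneg (by linarith) (by linarith [hwlo x hx'])
          have h4 : 0 ≤ (2 - ν) * (P * x) := mul_nonneg (by linarith) (mul_nonneg hP hx.1)
          have h5 : 0 ≤ P * x := mul_nonneg hP hx.1
          linarith) t ht
      have he : Real.exp (-1 * (t - 0)) ≤ 1 := Real.exp_le_one_iff.mpr (by linarith [ht.1])
      have h0 : 0 ≤ u 0 + w 0 - 3 * P * 0 := by rw [hu0]; linarith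
      have h1 : (u 0 + w 0 - 3 * P * 0) * Real.exp (-1 * (t - 0)) ≤ A + 1 :=
        (mul_le_of_le_one_right h0 he).trans (by rw [hu0]; linarith)
      linarith
    · have hE' : ∀ x ∈ Ico 0 T, HasDerivWithinAt (fun y => u y ^ 2 + v y ^ 2 + w y ^ 2)
          (2 * u x * (-u x - v x ^ 2 + p x) + 2 * v x * (v x * (u x - w x) - v x + s x) +
            2 * w x * (-ν * w x + v x ^ 2 + r x)) (Ici x) x := fun x hx => by
        refine ((((hu' x hx).fun_pow 2).add ((hv' x hx).fun_pow 2)).add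
          ((hw' x hx).fun_pow 2)).congr_deriv ?_
        norm_num
      have h := sub_le_mul_of_deriv_right_le (f := fun y => u y ^ 2 + v y ^ 2 + w y ^ 2)
        (M := 2 * P ^ 2) (a := 0) (b := T)
        (((hu.fun_pow 2).add (hv.fun_pow 2)).add (hw.fun_pow 2)) hE'
        (fun x hx => by
          have hx' := Ico_subset_Icc_self hx
          have e1 := abs_le.mp (hp x hx')
          have e2 := abs_le.mp (hr x hx')
          have e3 := hs x hx'
          have f1 : p x ^ 2 ≤ P ^ 2 := sq_le_sq' e1.1 e1.2
          have f2 : r x ^ 2 ≤ P ^ 2 := sq_le_sq' e2.1 e2.2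
          have f3 : s x ^ 2 ≤ P ^ 2 := sq_le_sq' (by linarith) e3.2
          have f4 : 0 ≤ (ν - 1) * w x ^ 2 := mul_nonneg (by linarith) (sq_nonneg _)
          linarith [sq_nonneg (2 * u x - p x), sq_nonneg (2 * v x - s x),
            sq_nonneg (2 * w x - r x), sq_nonneg P]) t ht
      have hv2 : v 0 ^ 2 ≤ 1 := pow_le_one₀ hv0.le hv1
      have hw2 : w 0 ^ 2 ≤ 1 := pow_le_one₀ hw0 hw1
      have hPt : P ^ 2 * t ≤ P ^ 2 * (1 / 2) := mul_le_mul_of_nonneg_left (ht.2.trans hT2) (sq_nonneg P)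
      have hAP : 0 ≤ A * P := mul_nonneg hA0.le hP
      have hsq : w t ^ 2 ≤ (A + 1 + P) ^ 2 := by
        rw [hu0] at h
        linarith [sq_nonneg (u t), sq_nonneg (v t)]
      exact (abs_le_of_sq_le_sq' hsq (by linarith)).2
  -- the continuity argument on `R ≥ A / 4`
  set R : ℝ → ℝ := fun t => Real.sqrt ((u t - w t) ^ 2 + 2 * v t ^ 2) with hRdef
  have hRc : ContinuousOn R (Icc 0 T) :=
    (((hu.sub hw).fun_pow 2).add (continuousOn_const.mul (hv.fun_pow 2))).sqrt
  have hP0 : A / 4 ≤ R 0 := by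
    have hlo : A - w 0 ≤ R 0 :=
      (Real.le_sqrt' (by linarith)).mpr (by rw [hu0]; linarith [sq_nonneg (v 0)])
    linarith
  have hclosed : ∀ t ∈ Ioc 0 T, (∀ s ∈ Ico 0 t, A / 4 ≤ R s) → A / 4 ≤ R t := by
    intro t ht h
    have h1 := le_const_of_forall_Ico (g := fun s => -R s) (C := -(A / 4)) hRc.neg ht
      (fun s hs => by have := h s hs; linarith)
    linarith
  set t₁ : ℝ := maximalTimeP (fun s => A / 4 ≤ R s) 0 T with ht₁
  have ht₁mem : t₁ ∈ Icc 0 T := maximalTimeP_mem (P := fun s => A / 4 ≤ R s) hT.le hP0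
  have hspec : ∀ t ∈ Icc 0 t₁, A / 4 ≤ R t := fun t ht =>
    maximalTimeP_spec (P := fun s => A / 4 ≤ R s) hT.le hP0 hclosed ht
  have hI : ∀ {t}, t ∈ Icc 0 t₁ → t ∈ Icc 0 T := fun ht => ⟨ht.1, ht.2.trans ht₁mem.2⟩
  have hI' : ∀ {t}, t ∈ Ico 0 t₁ → t ∈ Ico 0 T := fun ht => ⟨ht.1, ht.2.trans_le ht₁mem.2⟩
  have hcore := gate_core hν1 hν2 hP (ht₁mem.2.trans hT2) hA hu0 hw0 hw1 hv0.le hv1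
    (hu.mono (Icc_subset_Icc_right ht₁mem.2)) (hv.mono (Icc_subset_Icc_right ht₁mem.2))
    (hw.mono (Icc_subset_Icc_right ht₁mem.2)) (fun t ht => hu' t (hI' ht))
    (fun t ht => hv' t (hI' ht)) (fun t ht => hw' t (hI' ht)) (fun t ht => hp t (hI ht))
    (fun t ht => hr t (hI ht)) (fun t ht => hs t (hI ht)) (fun t ht => hwlo t (hI ht))
    (fun t ht => (hap t (hI ht)).2.2) hspec
  have ht₁T : t₁ = T := by
    rcases maximalTimeP_exit (P := fun s => A / 4 ≤ R s) hT.le hP0 with h | h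
    · exact h
    · refine absurd ?_ h
      have h3 : A / 3 ≤ R t₁ := (hcore t₁ ⟨ht₁mem.1, le_rfl⟩).2.1
      have hev : ∀ᶠ s in 𝓝[Icc 0 T] t₁, A / 4 < R s :=
        (hRc t₁ ht₁mem).eventually_const_lt (by linarith)
      exact hev.mono fun s hs => hs.le
  intro t ht
  have ht' : t ∈ Icc 0 t₁ := by rw [ht₁T]; exact ht
  obtain ⟨h1, h2, h3⟩ := hcore t ht'
  obtain ⟨g1, g3, -⟩ := hap t ht
  exact ⟨g1, hwlo t ht, h1, g3, h2, h3⟩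

end Summit.NavierStokesRegularity.NavierStokesRegularity.Theorems.PerpetualPumpCircuitPump
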